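import Literature.Analysis.Distribution.EllipticRegularity
import Literature.Analysis.Hypoelliptic.EllipticBootstrap
import HarnessLib

/-!
# Discharge of the named fact `Folland1995_cor634` (elliptic operators are hypoelliptic)

Sibling proofs file of `Literature/Analysis/Distribution/EllipticRegularity.lean`: the named fact
`Folland1995_cor634` (G. B. Folland, *Introduction to Partial Differential Equations*, 2nd ed.
(1995), Corollary (6.34): "Every elliptic operator with `C^∞` coefficients is hypoelliptic") is
PROVED. The proof is assembled in `Literature/Analysis/Hypoelliptic/EllipticBootstrap.lean`
(`isHypoellipticOn_of_isEllipticOn`) from the amplitude calculus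
(`Amplitude.lean`, `AmplitudeOperator.lean`), the crude parametrix of an elliptic operator
(`EllipticParametrix.lean`) and the Fourier-side toolkit of the proof of Hörmander's theorem
(`Literature/Analysis/Hypoelliptic/*`): a duality bootstrap gaining one Sobolev derivative per
step for the localized distribution, in place of Folland's a priori estimate (6.29) and
difference quotients (6.32).

## References

* G. B. Folland, *Introduction to Partial Differential Equations*, 2nd ed., Princeton Univ. Press
  (1995), Thm (6.33), Cor. (6.34) [Folland2020].
-/

namespace Literature.Analysis.Distribution

/-- **Folland 1995, Corollary (6.34) holds**: the named fact `Folland1995_cor634` — a linear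
differential operator `∑_{w ∈ S} a_w X_w` with smooth vector fields and coefficients on a
finite-dimensional real space of positive dimension, elliptic of order `k` on the open set `Ω`,
is hypoelliptic in `Ω` — is a theorem. [cite: Folland2020, Cor. (6.34)] -/
theorem Folland1995_cor634_holds : Folland1995_cor634 := by
  intro E _ _ _ _ _ _ μ _ ι Ω X S a k hX ha hell
  exact Literature.Analysis.Hypoelliptic.isHypoellipticOn_of_isEllipticOn μ hX ha hell

end Literature.Analysis.Distribution
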